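/-
Copyright: b2b-lace packet (LEAN TYPING SEAT 1 gen 33, node TPAIR-SEED, Lean half (L1)–(L2) of
`carver/g41/tpair/TPAIR-SEED-SPEC.md`).  The `x`-space evaluation of the Cauchy–Schwarz partner integral
`M₂_{c,m}` of [NoBLE17-I] (3.37) through `I`, `V` and the SIGNED one-`D̂^{sin}` integral `X` — valid for
`d ≥ 2c + 1` (the range of `M₂` itself), one `Ĉ²` beyond the range `d ≥ 2(c+2)+1` of `srwM2_eq`.
Elementary; hypothesis-free; no `sorry`; no statement at any specific dimension.

## Part II (section `AxisSquare`) — the square of an axis class through the classes `0`, `[2m]`, `[m,m]` (leaf KU-SEP-Q2)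

For the bounded separable majorant device (KU-SEP) the `q²`-moment at an axis node `x = m e_i` is needed in
LANDED `srwI` classes. Pointwise, for `i ≠ j` and every `m : ℤ`,
`D̂^{(m e_i)}(k)² = (1 + D̂^{(2m e_i)}(k))/(2d) + ((d−1)/d)·D̂^{(m e_i + m e_j)}(k)`
(`DhatSym_single_sq_eq_classes`; from `DhatSym_smul`, `DhatSym_single`, `Dhat_sq_eq` at the dilated point `m·k`,
and `DhatSym_single_two_add_single_two` at `(m/2)·k`), whence, integrated against a `K`-weight with EVEN exponent
(`2n + 1 ≤ d`):
`∫ |D̂|^{2l} (D̂^{(m e_i)})² Ĉⁿ dk/(2π)^d = (I_{n,2l}(0) + I_{n,2l}(2m e_i))/(2d) + ((d−1)/d)·I_{n,2l}(m e_i + m e_j)`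
(`integral_abs_Dhat_pow_even_mul_DhatSym_single_sq`; the case `l = 0` is `L_n(m e_i)`, `srwL_single_eq_classes`) —
plain seeds at dilated points, no new certificate class.
Drafted by the b2b-lace CARVER gen 43 (`carver/g43/q2/SrwDhatSymAxisSq.lean`, recipe in LEMMAS `carver-g43:lemmas1`),
checked and filed by LEAN TYPING SEAT 1 gen 33 as an extension of this file (the hub's check farm could not build
oleans for newly landed modules on 2026-08-21, so a separate module importing this one could not be verified).
[FitznerVanDerHofstad2016NoBLE, (3.34) p. 1071, (5.4) p. 1091, §5.2 p. 1093]

-/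
import Literature.Probability.FitznerVanDerHofstad2017.SrwIntegralM2Bounds
import Literature.Probability.FitznerVanDerHofstad2017.SrwWSplitJensen
import Literature.Probability.FitznerVanDerHofstad2017.SrwIntegralUZero
import HarnessLib

/-!
# `M₂_{c,m}` through `I`, `X`, `V` for `d ≥ 2c + 1` (route X of TPAIR-SEED)

CITATION HEADER (PLACEMENT v2). Part of the certified REPRODUCTION of the numerical inputs of
R. Fitzner, R. van der Hofstad, *Generalized approach to the non-backtracking lace expansion*,
Probab. Theory Related Fields 169 (2017) 1041–1119 [NoBLE17-I] (arXiv:1506.07969), §3.3.3 and §5.2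
((3.26), (3.35)–(3.38) p. 1070–1071; (5.7)–(5.13) p. 1091–1093), as consumed by *Mean-field behavior for
nearest-neighbor percolation in `d > 10`*, Electron. J. Probab. 22 (2017) no. 43 [FvdH17].
Origin: build `lace`, unit `b2b-lace-lean1-g33` (HOME node TPAIR-SEED, spec `carver/g41/tpair/TPAIR-SEED-SPEC.md`
items (L1), (L2); the numerical half — certified seeds `X_{5,·}`, `V_{5,·}`, `V_{6,·}` at `d = 10` — is the engines'
and the seed pipeline's, not this module's).  Nothing here is a statement about percolation and nothing is
evaluated at a specific `d`.

## What is proved, and why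

`SrwIntegralTPairing.lean` evaluates the Cauchy–Schwarz partner `M₂_{c,m} = ∫ D̂^{2m} M̂² Ĉ^c` (`M̂ = D̂ − 2 D̂^{sin} Ĉ`,
(3.26)) exactly through `I`, `V` (`srwM2_eq`) only for `d ≥ 2(c+2) + 1`, because it substitutes
`D̂^{sin} = (1 − D̂^{(2e_i)})/(2d)` in the cross term and integrates `D̂^{2m+1} Ĉ^{c+1}` and `D̂^{2m+1} D̂^{(2e_i)} Ĉ^{c+1}`
SEPARATELY; at the table dimension `d = 10` that restricts the exact route to `c ≤ 2`, and `SrwTPairTablesD10` falls back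
to the loose landed-objects-only routes G′/H (`srwM2_le_I_U`, `srwU_succ_sq_le`) for `c = 3, 4` (TPAIR-SEED-SPEC "Why").
Here the cross term is kept as ONE signed integral

* `srwX d p a = X_{p,a} := ∫ D̂^a D̂^{sin} Ĉ^p dk/(2π)^d` (definition; not an object of the source, notation of the spec),

whose integrand `D̂^a (D̂^{sin} Ĉ) Ĉ^{p−1}` is `(2/d)`-bounded times `Ĉ^{p−1}` ((5.10): the tree's `Dsin_mul_Chat_le`), hence
integrable already for `d ≥ 2(p−1) + 1` (`integrable_srwX_integrand_succ`), exactly as the `V_{p,·}`-integrand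
`D̂^a (D̂^{sin} Ĉ)² Ĉ^{p−2}` is for `d ≥ 2(p−2) + 1` (`integrable_srwV_integrand_succ_succ`).  With the pointwise identity
`D̂^{2m} M̂² Ĉ^c = D̂^{2m+2} D̂^{(0)} Ĉ^c − 4 D̂^{2m+1} D̂^{sin} Ĉ^{c+1} + 4 D̂^{2m} (D̂^{sin})² Ĉ^{c+2}` (`srwM2_integrand_eq_X`)
this gives, for `d ≥ 2c + 1` (the convergence range of `M₂_{c,m}` itself),

* **`srwM2_eq_X`**: `M₂_{c,m} = I_{c,2m+2}(0) − 4 X_{c+1,2m+1} + 4 V_{c+2,2m}`   (TPAIR-SEED-SPEC (L2));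

and, back in the generic range `d ≥ 2p + 1`, the substitution as a theorem about `X` (`srwX_eq_srwI_sub`):
`X_{p,a} = (I_{p,a}(0) − I_{p,a}(2e_i))/(2d)`, so that the statement of `srwM2_eq` holds already for `d ≥ 2(c+1) + 1`
(`srwM2_eq'`: route X followed by the substitution at `p = c+1`; at `d = 2c + 3` the only input beyond the `I`-tables is
`V_{c+2,·}`).  Sign fact: `X_{p,2j} ≥ 0` (`srwX_even_nonneg`); no domination `|X_{p+1,a}| ≤ (2/d)·(…)` is recorded here
(the odd-power `X`-seeds are to be certified directly, TPAIR-SEED-SPEC (S2)).  The recursion (5.1) in the `D̂`-power,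
`D̂ = 1 − [1 − D̂]`, one and two `Ĉ`-powers beyond the generic range: **`srwX_succ_succ`** `X_{p+1,a+1} = X_{p+1,a} − X_{p,a}`
and **`srwV_succ_succ_succ`** `V_{c+2,a+1} = V_{c+2,a} − V_{c+1,a}` (`d ≥ 2p + 1`, resp. `2c + 1`; with
`integrable_srwX_integrand`, `integrable_srwV_integrand_succ`) — so at `d = 10` each seed family `X_{5,·}`, `V_{5,·}`,
`V_{6,·}` is its `a = 0` member plus the family one `Ĉ`-power lower, down to the generic range of the landed tables.
Pointwise, `Dhat_sq_eq` and **`Dsin_sq_eq`**: `(D̂^{sin})² = (4d²)⁻¹[(1 + 1/(2d)) − 2D̂(2k) + (1/(2d))D̂(4k) + d⁻² Σ_j Σ_{l≠j}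
cos 2k_j cos 2k_l]` — the class expansion (`0`, `[2]`, `[4]`, `[2,2]`) from which `V_{n,·}` in the generic range is read off
the `I`-tables and from which a seed certificate of `V_{5,0}`, `V_{6,0}` starts and **`DhatSym_single_two_add_single_two`** identifies the pair sum with the class `[2,2]`:
`D̂^{(2e_i+2e_j)}(k) = Σ_aΣ_{b≠a} cos 2k_a cos 2k_b /(d(d−1))` (`i ≠ j`; pair average over `S_d` under `DhatSym_eq_sum_permProd`
of `SrwWSplitJensen`), whence **`Dsin_sq_eq_classes`** and the integral identity **`srwV_eq_srwI_classes`**: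
`V_{n,a} = (4d²)⁻¹[(1 + 1/(2d)) I_{n,a}(0) − 2 I_{n,a}(2e_i) + (1/(2d)) I_{n,a}(4e_i) + ((d−1)/d) I_{n,a}(2e_i+2e_j)]` for
`d ≥ 2n + 1` — at `d = 10` every `V_{4,·}` (and `V_{n,·}`, `n ≤ 4`) is an exact combination of the LANDED class tables
`v0`/`v01`/`v0001`/`v02`, so with the recursions the seed half of TPAIR-SEED reduces to the three numbers `X_{5,0}`, `V_{5,0}`,
`V_{6,0}` (engine B's `SEEDCERT-X-NOTE.md`; `HOME/lean1-g33/m2x/TPAIR-SEED-KERNEL-DESIGN.md`).  Table-ready corollaries with rational brackets as hypotheses: `srwM2_le_of_X_brackets`, `srwM2_le_of_I_brackets'`.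

USE.  A successor table module can re-certify the rows `m2Tab 3 ·`, `m2Tab 4 ·` of `SrwTPairTablesD10` at `d = 10` by
`srwM2_eq'` (`c = 3`: the landed `I`-tables + seed enclosures of `V_{5,·}`) and `srwM2_eq_X` (`c = 4`: seeds of `X_{5,·}`,
`V_{6,·}`) read BY NAME (TPAIR-SEED-SPEC (L3), (S1)–(S2); engine-B values NUMERICS §B160; no seed is in the tree yet).  Lane: what-if / input-certification support,
d-generic; nothing of record (CERT REV 14, `d = 11`) is touched and no `d = 10` number appears here.

Imports: `SrwIntegralM2Bounds` (the `M₂`/`U`/`V` objects and (5.10)) and `SrwWSplitJensen` (only for `permProd` /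
`DhatSym_eq_sum_permProd`).  Proof technique: `ring` for the pointwise identity (after `DhatSym_zero`, `Mhat`), `integrable_weight_mul_Chat_pow`
([HvdH17] Prop. 5.5 in the tree) with the bounded weights `D̂^a (D̂^{sin}Ĉ)/2`, `D̂^a (D̂^{sin}Ĉ)²/4`,
`D̂^a D̂^{sin}(D̂^{sin}Ĉ)/2`, `integral_add/sub/const_mul`, and `ae_Chat_mul_one_sub_Dhat` (`Ĉ[1 − D̂] = 1` a.e.) for the
recursions, exactly as in `srwI_succ_succ`; for the class `[2,2]`: `Finset.prod_eq_mul`, reindexing by `Equiv.mulRight` /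
`Equiv.inv`, `Finset.sum_comm`, and `Fintype.card_perm`.  Axioms: `propext`, `Classical.choice`, `Quot.sound`.

References: [NoBLE17-I] as above; [HvdH17] M. Heydenreich, R. van der Hofstad, *Progress in high-dimensional
percolation and random graphs*, Springer 2017, Prop. 5.5; [HS92b] T. Hara, G. Slade, Rev. Math. Phys. 4 (1992)
235–327, Lemma B.3 (the Schwarz-inequality device behind the pairing).
-/

open MeasureTheory Real Finset
open scoped BigOperators

namespace Literature.Probability.FitznerVanDerHofstad2017

open Literature.Barriers.CriticalPhenomena
open Literature.Barriers.CriticalPhenomena.Slade2006Prop53 (P)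

variable {d : ℕ}

/-! ### The signed one-`D̂^{sin}` integral `X_{p,a}` -/

/-- `X_{p,a} = ∫_{[-π,π]^d} D̂(k)^a D̂^{sin}(k) Ĉ(k)^p dk/(2π)^d` (a Bochner integral, SIGNED integrand; meaningful for
`d ≥ 2(p−1) + 1` since `D̂^{sin} Ĉ ≤ 2/d`).  Not an object of the source: the cross term of `M₂_{c,m}` ((3.26), (5.13))
kept whole, notation `X_{p,a}` of TPAIR-SEED-SPEC; for `d ≥ 2p + 1` it equals `(I_{p,a}(0) − I_{p,a}(2e_i))/(2d)`
(`srwX_eq_srwI_sub`). [folklore] -/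
noncomputable def srwX (d p a : ℕ) : ℝ :=
  (∫ k, (Dhat d k ^ a * Dsin d k) * Chat d 1 k ^ p ∂P d) / (2 * π) ^ d

/-! ### Integrability one and two `Ĉ`-powers beyond the generic range -/

/-- (L1) The `X_{c+1,a}`-integrand `D̂^a D̂^{sin} Ĉ^{c+1}` is integrable already for `d ≥ 2c + 1`: `D̂^{sin} Ĉ ≤ 2/d ≤ 2` is
bounded, so the weight `D̂^a (D̂^{sin} Ĉ)/2` has absolute value `≤ 1` against `Ĉ^c` ([HvdH17] Prop. 5.5 via the tree's
`integrable_weight_mul_Chat_pow`; pattern of `integrable_srwU_integrand_succ`). [cite: HeydenreichVanDerHofstad2017, Prop. 5.5] -/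
theorem integrable_srwX_integrand_succ {c : ℕ} (hd : 2 * c + 1 ≤ d) (a : ℕ) :
    Integrable (fun k => (Dhat d k ^ a * Dsin d k) * Chat d 1 k ^ (c + 1)) (P d) := by
  have hd1 : 1 ≤ d := by omega
  have hd0 : (1 : ℝ) ≤ d := by exact_mod_cast hd1
  have h := integrable_weight_mul_Chat_pow hd
    (w := fun k => (Dhat d k ^ a * (Dsin d k * Chat d 1 k)) / 2)
    ((((continuous_Dhat d).measurable.pow_const a).mul
      ((continuous_Dsin d).measurable.mul (measurable_Chat_one d))).div_const 2)
    fun k => by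
      have hDC : Dsin d k * Chat d 1 k ≤ 2 / d := Dsin_mul_Chat_le hd1 k
      have h2d : (2 : ℝ) / d ≤ 2 := by
        rw [div_le_iff₀ (by linarith)]
        linarith
      have hA : |Dhat d k| ^ a ≤ 1 := abs_Dhat_pow_le_one a k
      have hA0 : 0 ≤ |Dhat d k| ^ a := pow_nonneg (abs_nonneg _) a
      have hB : 0 ≤ Dsin d k * Chat d 1 k := mul_nonneg (Dsin_nonneg k) (Chat_one_nonneg k)
      simp only [abs_div, abs_mul, abs_pow, abs_of_nonneg hB, abs_of_pos (by norm_num : (0 : ℝ) < 2)]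
      rw [div_le_one (by norm_num)]
      nlinarith [mul_nonneg (sub_nonneg.2 hA) hB]
  refine (h.const_mul 2).congr (ae_of_all _ fun k => ?_)
  simp only
  ring

/-- (L1) The `V_{c+2,a}`-integrand `D̂^a (D̂^{sin})² Ĉ^{c+2}` is integrable already for `d ≥ 2c + 1`: the weight
`D̂^a (D̂^{sin} Ĉ)²/4` has absolute value `≤ 1` against `Ĉ^c`. [cite: HeydenreichVanDerHofstad2017, Prop. 5.5] -/
theorem integrable_srwV_integrand_succ_succ {c : ℕ} (hd : 2 * c + 1 ≤ d) (a : ℕ) :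
    Integrable (fun k => (Dhat d k ^ a * Dsin d k ^ 2) * Chat d 1 k ^ (c + 2)) (P d) := by
  have hd1 : 1 ≤ d := by omega
  have hd0 : (1 : ℝ) ≤ d := by exact_mod_cast hd1
  have h := integrable_weight_mul_Chat_pow hd
    (w := fun k => (Dhat d k ^ a * (Dsin d k * Chat d 1 k) ^ 2) / 4)
    ((((continuous_Dhat d).measurable.pow_const a).mul
      (((continuous_Dsin d).measurable.mul (measurable_Chat_one d)).pow_const 2)).div_const 4)
    fun k => by
      have hDC : Dsin d k * Chat d 1 k ≤ 2 / d := Dsin_mul_Chat_le hd1 k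
      have h2d : (2 : ℝ) / d ≤ 2 := by
        rw [div_le_iff₀ (by linarith)]
        linarith
      have hA : |Dhat d k| ^ a ≤ 1 := abs_Dhat_pow_le_one a k
      have hA0 : 0 ≤ |Dhat d k| ^ a := pow_nonneg (abs_nonneg _) a
      have hB : 0 ≤ Dsin d k * Chat d 1 k := mul_nonneg (Dsin_nonneg k) (Chat_one_nonneg k)
      have hB2 : (Dsin d k * Chat d 1 k) ^ 2 ≤ 2 ^ 2 :=
        pow_le_pow_left₀ hB (hDC.trans h2d) 2
      simp only [abs_div, abs_mul, abs_pow, abs_of_nonneg hB, abs_of_pos (by norm_num : (0 : ℝ) < 4)]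
      rw [div_le_one (by norm_num)]
      nlinarith [mul_nonneg (sub_nonneg.2 hA) (sq_nonneg (Dsin d k * Chat d 1 k))]
  refine (h.const_mul 4).congr (ae_of_all _ fun k => ?_)
  simp only
  ring

/-! ### `M₂` through `I`, `X`, `V` -/

/-- Pointwise expansion of the `M₂`-integrand with the cross term kept whole:
`D̂^{2m} M̂² Ĉ^c = D̂^{2m+2} D̂^{(0)} Ĉ^c − 4 D̂^{2m+1} D̂^{sin} Ĉ^{c+1} + 4 D̂^{2m} (D̂^{sin})² Ĉ^{c+2}`
(`M̂ = D̂ − 2 D̂^{sin} Ĉ`, `D̂^{(0)} = 1`). [cite: FitznerVanDerHofstad2016NoBLE, (3.26) p. 1070, §5.2 (5.13) p. 1092–1093] -/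
theorem srwM2_integrand_eq_X (c m : ℕ) (k : Fin d → ℝ) :
    (Dhat d k ^ (2 * m) * Mhat d k ^ 2) * Chat d 1 k ^ c =
      (Dhat d k ^ (2 * m + 2) * DhatSym d 0 k) * Chat d 1 k ^ c
        - 4 * ((Dhat d k ^ (2 * m + 1) * Dsin d k) * Chat d 1 k ^ (c + 1))
        + 4 * ((Dhat d k ^ (2 * m) * Dsin d k ^ 2) * Chat d 1 k ^ (c + 2)) := by
  rw [DhatSym_zero, Mhat]
  ring

/-- **(L2) `x`-space evaluation of `M₂` in the full range `d ≥ 2c + 1`: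
`M₂_{c,m} = I_{c,2m+2}(0) − 4 X_{c+1,2m+1} + 4 V_{c+2,2m}`** (TPAIR-SEED-SPEC route X).
[cite: FitznerVanDerHofstad2016NoBLE, §5.2 (5.13) p. 1092–1093] -/
theorem srwM2_eq_X {c : ℕ} (hd : 2 * c + 1 ≤ d) (m : ℕ) :
    srwM2 d c m = srwI d c (2 * m + 2) 0 - 4 * srwX d (c + 1) (2 * m + 1) + 4 * srwV d (c + 2) (2 * m) := by
  have hA := integrable_srwI_integrand hd (2 * m + 2) (0 : Fin d → ℤ)
  have hX := integrable_srwX_integrand_succ hd (2 * m + 1) (d := d)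
  have hV := integrable_srwV_integrand_succ_succ hd (2 * m) (d := d)
  have h4X : Integrable (fun k => 4 * ((Dhat d k ^ (2 * m + 1) * Dsin d k) * Chat d 1 k ^ (c + 1))) (P d) :=
    hX.const_mul _
  have h4V : Integrable (fun k => 4 * ((Dhat d k ^ (2 * m) * Dsin d k ^ 2) * Chat d 1 k ^ (c + 2))) (P d) :=
    hV.const_mul _
  have hAX : Integrable (fun k => (Dhat d k ^ (2 * m + 2) * DhatSym d 0 k) * Chat d 1 k ^ c
      - 4 * ((Dhat d k ^ (2 * m + 1) * Dsin d k) * Chat d 1 k ^ (c + 1))) (P d) :=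
    hA.sub h4X
  have e : ∫ k, (Dhat d k ^ (2 * m) * Mhat d k ^ 2) * Chat d 1 k ^ c ∂P d =
      ∫ k, ((Dhat d k ^ (2 * m + 2) * DhatSym d 0 k) * Chat d 1 k ^ c
        - 4 * ((Dhat d k ^ (2 * m + 1) * Dsin d k) * Chat d 1 k ^ (c + 1))
        + 4 * ((Dhat d k ^ (2 * m) * Dsin d k ^ 2) * Chat d 1 k ^ (c + 2))) ∂P d :=
    integral_congr_ae (ae_of_all _ fun k => srwM2_integrand_eq_X c m k)
  unfold srwM2 srwI srwX srwV
  rw [e, integral_add hAX h4V, integral_sub hA h4X, integral_const_mul, integral_const_mul]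
  ring

/-! ### Back in the generic range: the `D̂^{sin}` substitution as a theorem about `X` -/

/-- For `d ≥ 2p + 1` and any axis `i`: `X_{p,a} = (I_{p,a}(0) − I_{p,a}(2e_i))/(2d)`
(`D̂^{sin} = (1 − D̂^{(2e_i)})/(2d)`, both `I`-integrands integrable separately).
[cite: FitznerVanDerHofstad2016NoBLE, §5.2 (5.13) p. 1092–1093] -/
theorem srwX_eq_srwI_sub {p : ℕ} (hd : 2 * p + 1 ≤ d) (a : ℕ) (i : Fin d) :
    srwX d p a = (srwI d p a 0 - srwI d p a (Pi.single i 2)) / (2 * d) := by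
  have hd1 : 1 ≤ d := by omega
  haveI : NeZero d := ⟨by omega⟩
  have hd0 : (d : ℝ) ≠ 0 := by exact_mod_cast (NeZero.ne d)
  have hB := integrable_srwI_integrand hd a (0 : Fin d → ℤ)
  have hB' := integrable_srwI_integrand hd a (Pi.single i (2 : ℤ))
  have hS : ∀ k : Fin d → ℝ, Dsin d k = (DhatSym d 0 k - DhatSym d (Pi.single i 2) k) / (2 * d) := by
    intro k
    rw [DhatSym_single_two, Dsin_eq_half_angle hd1 k, DhatSym_zero]
  have e : ∫ k, (Dhat d k ^ a * Dsin d k) * Chat d 1 k ^ p ∂P d =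
      ∫ k, (1 / (2 * (d : ℝ))) * ((Dhat d k ^ a * DhatSym d 0 k) * Chat d 1 k ^ p
        - (Dhat d k ^ a * DhatSym d (Pi.single i 2) k) * Chat d 1 k ^ p) ∂P d :=
    integral_congr_ae (ae_of_all _ fun k => by simp only [hS k]; ring)
  unfold srwX srwI
  rw [e, integral_const_mul, integral_sub hB hB']
  ring

/-- **`srwM2_eq` one `Ĉ`-power further**: the statement of `srwM2_eq` (any axis `i`),
`M₂_{c,m} = I_{c,2m+2}(0) − (2/d) [I_{c+1,2m+1}(0) − I_{c+1,2m+1}(2e_i)] + 4 V_{c+2,2m}`, already for `d ≥ 2(c+1) + 1`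
(instead of `d ≥ 2(c+2) + 1`): route X followed by the substitution `srwX_eq_srwI_sub` at `p = c + 1`; the last integral
`V_{c+2,2m}` converges by `integrable_srwV_integrand_succ_succ`.  (At a table dimension `d` this is the exact `I`-table route
for `c = (d−3)/2` with `V_{c+2,·}` as the only input beyond the `I`-tables.)
[cite: FitznerVanDerHofstad2016NoBLE, §5.2 (5.13) p. 1092–1093] -/
theorem srwM2_eq' {c : ℕ} (hd : 2 * (c + 1) + 1 ≤ d) (m : ℕ) (i : Fin d) :
    srwM2 d c m =
      srwI d c (2 * m + 2) 0 - 2 / d * (srwI d (c + 1) (2 * m + 1) 0 - srwI d (c + 1) (2 * m + 1) (Pi.single i 2))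
        + 4 * srwV d (c + 2) (2 * m) := by
  haveI : NeZero d := ⟨by omega⟩
  have hd0 : (d : ℝ) ≠ 0 := by exact_mod_cast (NeZero.ne d)
  rw [srwM2_eq_X (show 2 * c + 1 ≤ d by omega) m, srwX_eq_srwI_sub hd (2 * m + 1) i]
  field_simp
  ring

/-! ### Sign facts -/

/-- `X_{p,2j} ≥ 0` (even `D̂`-power; `D̂^{sin}, Ĉ ≥ 0` — the sign of the (3.26) correction term's weight).
[cite: FitznerVanDerHofstad2016NoBLE, §3.3.3 (3.26) p. 1070] -/
theorem srwX_even_nonneg (p j : ℕ) : 0 ≤ srwX d p (2 * j) :=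
  div_nonneg (integral_nonneg fun k => mul_nonneg
    (mul_nonneg (by rw [pow_mul]; exact pow_nonneg (sq_nonneg _) j) (Dsin_nonneg k))
    (pow_nonneg (Chat_one_nonneg k) p)) (two_pi_pow_pos d).le

/-- `V_{p,a}`-free lower bound of route X for even `m`-independent use: `M₂_{c,m} ≤ I_{c,2m+2}(0) + 4 V_{c+2,2m}` would need
`X ≥ 0`, which holds for the ODD power `2m+1` only where `D̂ ≥ 0`; no such bound is claimed.  What IS immediate:
`M₂_{c,m} + 4 X_{c+1,2m+1} = I_{c,2m+2}(0) + 4 V_{c+2,2m}` (rearrangement of `srwM2_eq_X`, the form in which a consumer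
holding two-sided enclosures of `X` and `V` and the `I`-table brackets `M₂` from both sides).
[cite: FitznerVanDerHofstad2016NoBLE, §5.2 (5.13) p. 1092–1093] -/
theorem srwM2_add_four_srwX_eq {c : ℕ} (hd : 2 * c + 1 ≤ d) (m : ℕ) :
    srwM2 d c m + 4 * srwX d (c + 1) (2 * m + 1) = srwI d c (2 * m + 2) 0 + 4 * srwV d (c + 2) (2 * m) := by
  rw [srwM2_eq_X hd m]
  ring

/-! ### The recursion (5.1) in the `D̂`-power, one and two `Ĉ`-powers beyond the generic range

`D̂ = 1 − [1 − D̂]` and `Ĉ[1 − D̂] = 1` a.e.: raising `a` lowers the `Ĉ`-power, so each family `X_{p+1,·}`,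
`V_{c+2,·}` is determined by its `a = 0` member and the family one `Ĉ`-power lower (which at `d = 10`,
`p + 1 = 5`, `c + 2 = 5, 6` ends in the generic range of the landed tables). -/

/-- The `X`-integrand `D̂^a D̂^{sin} Ĉ^p` is integrable in the generic range `d ≥ 2p + 1` (`0 ≤ D̂^{sin} ≤ 1`).
[cite: FitznerVanDerHofstad2016NoBLE, §3.3.3 (3.35)–(3.38) p. 1071] -/
theorem integrable_srwX_integrand {p : ℕ} (hd : 2 * p + 1 ≤ d) (a : ℕ) :
    Integrable (fun k => (Dhat d k ^ a * Dsin d k) * Chat d 1 k ^ p) (P d) := by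
  have hd1 : 1 ≤ d := by omega
  refine integrable_weight_mul_Chat_pow hd
    (((continuous_Dhat d).measurable.pow_const a).mul (continuous_Dsin d).measurable) fun k => ?_
  rw [abs_mul, abs_pow, abs_of_nonneg (Dsin_nonneg k)]
  exact mul_le_one₀ (abs_Dhat_pow_le_one a k) (Dsin_nonneg k) (Dsin_le_one hd1 k)

/-- The `V`-integrand one `Ĉ`-power beyond the generic range, `D̂^a (D̂^{sin})² Ĉ^{c+1}` with `d ≥ 2c + 1`, is
integrable (`(D̂^{sin})² Ĉ ≤ D̂^{sin} · D̂^{sin}Ĉ ≤ 2`). [cite: HeydenreichVanDerHofstad2017, Prop. 5.5] -/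
theorem integrable_srwV_integrand_succ {c : ℕ} (hd : 2 * c + 1 ≤ d) (a : ℕ) :
    Integrable (fun k => (Dhat d k ^ a * Dsin d k ^ 2) * Chat d 1 k ^ (c + 1)) (P d) := by
  have hd1 : 1 ≤ d := by omega
  have hd0 : (1 : ℝ) ≤ d := by exact_mod_cast hd1
  have h := integrable_weight_mul_Chat_pow hd
    (w := fun k => (Dhat d k ^ a * Dsin d k * (Dsin d k * Chat d 1 k)) / 2)
    (((((continuous_Dhat d).measurable.pow_const a).mul (continuous_Dsin d).measurable).mul
      ((continuous_Dsin d).measurable.mul (measurable_Chat_one d))).div_const 2)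
    fun k => by
      have hDC : Dsin d k * Chat d 1 k ≤ 2 / d := Dsin_mul_Chat_le hd1 k
      have h2d : (2 : ℝ) / d ≤ 2 := by
        rw [div_le_iff₀ (by linarith)]
        linarith
      have hA : |Dhat d k| ^ a ≤ 1 := abs_Dhat_pow_le_one a k
      have hA0 : 0 ≤ |Dhat d k| ^ a := pow_nonneg (abs_nonneg _) a
      have hS : Dsin d k ≤ 1 := Dsin_le_one hd1 k
      have hS0 : 0 ≤ Dsin d k := Dsin_nonneg k
      have hB : 0 ≤ Dsin d k * Chat d 1 k := mul_nonneg (Dsin_nonneg k) (Chat_one_nonneg k)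
      simp only [abs_div, abs_mul, abs_pow, abs_of_nonneg hS0, abs_of_nonneg hB,
        abs_of_pos (by norm_num : (0 : ℝ) < 2)]
      rw [div_le_one (by norm_num)]
      nlinarith [mul_nonneg (sub_nonneg.2 hA) (mul_nonneg hS0 hB), mul_nonneg (sub_nonneg.2 hS) hB,
        mul_nonneg hA0 (mul_nonneg hS0 hB)]
  refine (h.const_mul 2).congr (ae_of_all _ fun k => ?_)
  simp only
  ring

/-- **`X_{p+1,a+1} = X_{p+1,a} − X_{p,a}`** (`d ≥ 2p + 1`). [cite: FitznerVanDerHofstad2016NoBLE, (5.1) p. 1090] -/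
theorem srwX_succ_succ {p : ℕ} (hd : 2 * p + 1 ≤ d) (a : ℕ) :
    srwX d (p + 1) (a + 1) = srwX d (p + 1) a - srwX d p a := by
  have hA := integrable_srwX_integrand_succ hd a
  have hB := integrable_srwX_integrand hd a
  unfold srwX
  rw [← sub_div, ← integral_sub hA hB]
  congr 1
  refine integral_congr_ae ?_
  filter_upwards [ae_Chat_mul_one_sub_Dhat (d := d) (by omega)] with k hk
  linear_combination (-(Dhat d k ^ a * Dsin d k * Chat d 1 k ^ p)) * hk

/-- **`V_{c+2,a+1} = V_{c+2,a} − V_{c+1,a}`** (`d ≥ 2c + 1`). [cite: FitznerVanDerHofstad2016NoBLE, (5.1) p. 1090] -/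
theorem srwV_succ_succ_succ {c : ℕ} (hd : 2 * c + 1 ≤ d) (a : ℕ) :
    srwV d (c + 2) (a + 1) = srwV d (c + 2) a - srwV d (c + 1) a := by
  have hA := integrable_srwV_integrand_succ_succ hd a
  have hB := integrable_srwV_integrand_succ hd a
  unfold srwV
  rw [← sub_div, ← integral_sub hA hB]
  congr 1
  refine integral_congr_ae ?_
  filter_upwards [ae_Chat_mul_one_sub_Dhat (d := d) (by omega)] with k hk
  linear_combination (-(Dhat d k ^ a * Dsin d k ^ 2 * Chat d 1 k ^ (c + 1))) * hk

/-! ### `(D̂^{sin})²` through `D̂(2k)`, `D̂(4k)` and the off-diagonal pair sum (pointwise; the class expansion a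
seed certificate / a `V`-from-tables identity starts from) -/
/-- `D̂(k)² = (1 + D̂(2k))/(2d) + d⁻² Σ_j Σ_{l ≠ j} cos k_j cos k_l` (`cos² t = (1 + cos 2t)/2`; `d ≥ 1`): the square of
the step function (3.34) expanded over classes, as used for `D̂^{sin}(k)² = (2d)⁻²[1 − D̂(2k)]²` in §5.2.
[cite: FitznerVanDerHofstad2016NoBLE, (3.34) p. 1071 and §5.2 p. 1093] -/
theorem Dhat_sq_eq (hd : 1 ≤ d) (k : Fin d → ℝ) :
    Dhat d k ^ 2 = (1 + Dhat d (fun j => 2 * k j)) / (2 * d)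
      + (∑ j, ∑ l ∈ univ.erase j, Real.cos (k j) * Real.cos (k l)) / (d : ℝ) ^ 2 := by
  haveI : NeZero d := ⟨by omega⟩
  have hd0 : (d : ℝ) ≠ 0 := by exact_mod_cast (NeZero.ne d)
  have hsq : (∑ j, Real.cos (k j)) ^ 2
      = ∑ j, Real.cos (k j) ^ 2 + ∑ j, ∑ l ∈ univ.erase j, Real.cos (k j) * Real.cos (k l) := by
    rw [sq, Finset.sum_mul_sum, ← Finset.sum_add_distrib]
    refine Finset.sum_congr rfl fun j _ => ?_
    rw [← Finset.add_sum_erase _ _ (mem_univ j), sq]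
  have hcos : ∑ j, Real.cos (k j) ^ 2 = (d + ∑ j, Real.cos (2 * k j)) / 2 := by
    simp_rw [Real.cos_sq]
    rw [Finset.sum_add_distrib, Finset.sum_const, Finset.card_univ, Fintype.card_fin, ← Finset.sum_div]
    simp
    ring
  unfold Dhat
  rw [div_pow, hsq, hcos]
  field_simp

/-- **`(D̂^{sin})²` through `D̂(2k)`, `D̂(4k)` and the off-diagonal pair sum**:
`D̂^{sin}(k)² = (4d²)⁻¹ [ (1 + 1/(2d)) − 2 D̂(2k) + (1/(2d)) D̂(4k) + d⁻² Σ_j Σ_{l≠j} cos 2k_j cos 2k_l ]` (`d ≥ 1`);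
integrated against `D̂^a Ĉⁿ`, the last term is the class `[2,2]` of the `I`-tables and the others the classes `0`, `[2]`,
`[4]`. [cite: FitznerVanDerHofstad2016NoBLE, §5.2 p. 1093 ("D̂^{sin}(k)² = (2d)⁻²[1 − D̂(2k)]²")] -/
theorem Dsin_sq_eq (hd : 1 ≤ d) (k : Fin d → ℝ) :
    Dsin d k ^ 2 = ((1 + 1 / (2 * d)) - 2 * Dhat d (fun j => 2 * k j) + (1 / (2 * d)) * Dhat d (fun j => 4 * k j)
      + (∑ j, ∑ l ∈ univ.erase j, Real.cos (2 * k j) * Real.cos (2 * k l)) / (d : ℝ) ^ 2) / (4 * (d : ℝ) ^ 2) := by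
  haveI : NeZero d := ⟨by omega⟩
  have hd0 : (d : ℝ) ≠ 0 := by exact_mod_cast (NeZero.ne d)
  have h2 := Dhat_sq_eq hd (fun j => 2 * k j)
  have h4 : (fun j => 2 * (2 * k j)) = fun j => 4 * k j := by funext j; ring
  rw [h4] at h2
  rw [Dsin_eq_half_angle hd k, div_pow, sub_sq, h2]
  field_simp
  ring

/-! ### Table-ready corollaries (a consumer holding rational brackets read by name) -/

/-- Route X, table form: `I_{c,2m+2}(0) ≤ a`, `b ≤ X_{c+1,2m+1}`, `V_{c+2,2m} ≤ v` ⟹ `M₂_{c,m} ≤ a − 4b + 4v` (`d ≥ 2c + 1`).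
[cite: FitznerVanDerHofstad2016NoBLE, §5.2 (5.13) p. 1092–1093] -/
theorem srwM2_le_of_X_brackets {c : ℕ} (hd : 2 * c + 1 ≤ d) (m : ℕ) {a b v : ℝ}
    (hI : srwI d c (2 * m + 2) 0 ≤ a) (hX : b ≤ srwX d (c + 1) (2 * m + 1)) (hV : srwV d (c + 2) (2 * m) ≤ v) :
    srwM2 d c m ≤ a - 4 * b + 4 * v := by
  rw [srwM2_eq_X hd m]
  linarith

/-- `srwM2_eq'`, table form: `I_{c,2m+2}(0) ≤ a`, `b ≤ I_{c+1,2m+1}(0)`, `I_{c+1,2m+1}(2e_i) ≤ a'`, `V_{c+2,2m} ≤ v`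
⟹ `M₂_{c,m} ≤ a − (2/d)(b − a') + 4v` (`d ≥ 2(c+1) + 1`; the shape of route E of `SrwTPairTablesD10.m2Chk`, one `c` further).
[cite: FitznerVanDerHofstad2016NoBLE, §5.2 (5.13) p. 1092–1093] -/
theorem srwM2_le_of_I_brackets' {c : ℕ} (hd : 2 * (c + 1) + 1 ≤ d) (m : ℕ) (i : Fin d) {a b a' v : ℝ}
    (hI : srwI d c (2 * m + 2) 0 ≤ a) (hb : b ≤ srwI d (c + 1) (2 * m + 1) 0)
    (ha' : srwI d (c + 1) (2 * m + 1) (Pi.single i 2) ≤ a') (hV : srwV d (c + 2) (2 * m) ≤ v) :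
    srwM2 d c m ≤ a - 2 / d * (b - a') + 4 * v := by
  have hd0 : (0 : ℝ) < d := by exact_mod_cast (show 0 < d by omega)
  have h2d : (0 : ℝ) ≤ 2 / d := div_nonneg zero_le_two hd0.le
  rw [srwM2_eq' hd m i]
  nlinarith [mul_le_mul_of_nonneg_left (show b - a' ≤ srwI d (c + 1) (2 * m + 1) 0
    - srwI d (c + 1) (2 * m + 1) (Pi.single i 2) by linarith) h2d]


/-! ### The class `[2,2]` of `D̂^{(x)}`: pair average over the hyperoctahedral symmetrisation

`D̂^{(2e_i+2e_j)}(k) = (d!)⁻¹ Σ_ν Π_l cos(x_{νl} k_l) = (d!)⁻¹ Σ_ν cos 2k_{ν⁻¹i} cos 2k_{ν⁻¹j}` (`DhatSym_eq_sum_permProd`), and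
`Σ_ν g(νi, νj) = (d−2)! Σ_a Σ_{b≠a} g(a,b)` by transitivity of `S_d` on ordered pairs (sum the pair-independence over all
`d(d−1)` pairs and exchange). -/

/-- The off-diagonal pair sum `Σ_a Σ_{b ≠ a} g(a, b)` written with an `ite`. [folklore] -/
private theorem sum_erase_eq_sum_ite (g : Fin d → Fin d → ℝ) :
    (∑ a, ∑ b ∈ univ.erase a, g a b) = ∑ a, ∑ b, if b = a then 0 else g a b := by
  refine Finset.sum_congr rfl fun a _ => ?_
  rw [← Finset.sum_erase_add univ (fun b => if b = a then (0 : ℝ) else g a b) (mem_univ a), if_pos rfl,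
    add_zero]
  exact Finset.sum_congr rfl fun b hb => (if_neg (Finset.ne_of_mem_erase hb)).symm

/-- `permProd` of `2e_i + 2e_j` (`i ≠ j`): `Π_l cos(x_{ν l} k_l) = cos(2 k_{ν⁻¹ i}) cos(2 k_{ν⁻¹ j})`. [folklore] -/
private theorem permProd_single_add_single {i j : Fin d} (hij : i ≠ j) (k : Fin d → ℝ) (ν : Equiv.Perm (Fin d)) :
    permProd (Pi.single i (2 : ℤ) + Pi.single j 2) k ν
      = Real.cos (2 * k (ν.symm i)) * Real.cos (2 * k (ν.symm j)) := by
  classical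
  unfold permProd
  have hab : ν.symm i ≠ ν.symm j := fun h => hij (ν.symm.injective h)
  rw [Finset.prod_eq_mul (ν.symm i) (ν.symm j) hab]
  · simp [Pi.add_apply, Equiv.apply_symm_apply, Pi.single_eq_same, Pi.single_eq_of_ne hij,
      Pi.single_eq_of_ne hij.symm]
  · intro c _ hc
    have h1 : ν c ≠ i := fun h => hc.1 (by rw [← h, Equiv.symm_apply_apply])
    have h2 : ν c ≠ j := fun h => hc.2 (by rw [← h, Equiv.symm_apply_apply])
    simp [Pi.add_apply, Pi.single_eq_of_ne h1, Pi.single_eq_of_ne h2]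
  · intro h; exact absurd (mem_univ _) h
  · intro h; exact absurd (mem_univ _) h

/-- Transitivity of `S_d` on ordered pairs of distinct indices: a permutation with `τ i = i'`, `τ j = j'`. [folklore] -/
private theorem exists_perm_map_pair {i j i' j' : Fin d} (hij : i ≠ j) (hij' : i' ≠ j') :
    ∃ τ : Equiv.Perm (Fin d), τ i = i' ∧ τ j = j' := by
  classical
  set τ₁ : Equiv.Perm (Fin d) := Equiv.swap i i' with hτ₁
  have h1 : τ₁ i = i' := by simp [hτ₁]
  have hc : τ₁ j ≠ i' := by rw [← h1]; exact fun h => hij (τ₁.injective h).symm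
  refine ⟨Equiv.swap (τ₁ j) j' * τ₁, ?_, ?_⟩
  · rw [Equiv.Perm.mul_apply, h1, Equiv.swap_apply_of_ne_of_ne hc.symm hij']
  · rw [Equiv.Perm.mul_apply, Equiv.swap_apply_left]

/-- `Σ_{ν ∈ S_d} g(ν i', ν j')` does not depend on the ordered pair `(i', j')` of distinct indices. [folklore] -/
private theorem sum_perm_pair_indep (g : Fin d → Fin d → ℝ) {i j i' j' : Fin d} (hij : i ≠ j) (hij' : i' ≠ j') :
    ∑ ν : Equiv.Perm (Fin d), g (ν i') (ν j') = ∑ ν : Equiv.Perm (Fin d), g (ν i) (ν j) := by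
  obtain ⟨τ, hτi, hτj⟩ := exists_perm_map_pair hij hij'
  rw [← Equiv.sum_comp (Equiv.mulRight τ) (fun ν : Equiv.Perm (Fin d) => g (ν i) (ν j))]
  refine Finset.sum_congr rfl fun ν _ => ?_
  simp [Equiv.coe_mulRight, Equiv.Perm.mul_apply, hτi, hτj]

/-- **Pair average over `S_d`**: `Σ_ν g(ν i, ν j) = (d−2)!·Σ_a Σ_{b≠a} g(a,b)`, in the form
`d(d−1)·Σ_ν g(ν i, ν j) = d!·Σ_a Σ_{b≠a} g(a,b)` (`i ≠ j`). [folklore] -/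
private theorem sum_perm_pair_eq (g : Fin d → Fin d → ℝ) {i j : Fin d} (hij : i ≠ j) :
    ((d : ℝ) * (d - 1)) * ∑ ν : Equiv.Perm (Fin d), g (ν i) (ν j)
      = (d.factorial : ℝ) * ∑ a, ∑ b ∈ univ.erase a, g a b := by
  classical
  -- sum the invariance over all ordered pairs (i', j'), j' ≠ i'
  have hL : ∑ i' : Fin d, ∑ j' ∈ univ.erase i', ∑ ν : Equiv.Perm (Fin d), g (ν i') (ν j')
      = ((d : ℝ) * (d - 1)) * ∑ ν : Equiv.Perm (Fin d), g (ν i) (ν j) := by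
    have : ∀ i' : Fin d, ∑ j' ∈ univ.erase i', ∑ ν : Equiv.Perm (Fin d), g (ν i') (ν j')
        = ((d : ℝ) - 1) * ∑ ν : Equiv.Perm (Fin d), g (ν i) (ν j) := by
      intro i'
      rw [Finset.sum_congr rfl fun j' hj' => sum_perm_pair_indep g hij (Finset.ne_of_mem_erase hj').symm,
        Finset.sum_const, Finset.card_erase_of_mem (mem_univ i'), Finset.card_univ, Fintype.card_fin,
        nsmul_eq_mul]
      have hd1 : 1 ≤ d := by
        rcases Nat.eq_zero_or_pos d with h | h
        · subst h; exact Fin.elim0 i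
        · exact h
      push_cast [Nat.cast_sub hd1]
      ring
    rw [Finset.sum_congr rfl fun i' _ => this i', Finset.sum_const, Finset.card_univ, Fintype.card_fin,
      nsmul_eq_mul]
    ring
  -- and exchange the sums, reindexing the inner pair sum by ν
  have hR : ∑ i' : Fin d, ∑ j' ∈ univ.erase i', ∑ ν : Equiv.Perm (Fin d), g (ν i') (ν j')
      = (d.factorial : ℝ) * ∑ a, ∑ b ∈ univ.erase a, g a b := by
    have hite : ∀ i' j' : Fin d, (if j' = i' then (0 : ℝ) else ∑ ν : Equiv.Perm (Fin d), g (ν i') (ν j'))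
        = ∑ ν : Equiv.Perm (Fin d), if j' = i' then (0 : ℝ) else g (ν i') (ν j') := by
      intro i' j'
      split_ifs <;> simp
    have hinner : ∀ ν : Equiv.Perm (Fin d),
        ∑ i' : Fin d, ∑ j' : Fin d, (if j' = i' then (0 : ℝ) else g (ν i') (ν j'))
          = ∑ a, ∑ b, if b = a then (0 : ℝ) else g a b := by
      intro ν
      rw [← Equiv.sum_comp ν (fun a => ∑ b, if b = a then (0 : ℝ) else g a b)]
      refine Finset.sum_congr rfl fun i' _ => ?_
      rw [← Equiv.sum_comp ν (fun b => if b = ν i' then (0 : ℝ) else g (ν i') b)]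
      refine Finset.sum_congr rfl fun j' _ => ?_
      simp only [ν.injective.eq_iff]
    rw [sum_erase_eq_sum_ite (fun i' j' => ∑ ν : Equiv.Perm (Fin d), g (ν i') (ν j'))]
    simp_rw [hite]
    rw [Finset.sum_congr rfl fun i' _ => Finset.sum_comm, Finset.sum_comm]
    simp_rw [hinner]
    rw [Finset.sum_const, Finset.card_univ, Fintype.card_perm, Fintype.card_fin, nsmul_eq_mul,
      sum_erase_eq_sum_ite g]
  rw [← hL, hR]

/-- **The class `[2,2]` of the symmetrised step function**: for `i ≠ j` (so `d ≥ 2`),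
`D̂^{(2e_i + 2e_j)}(k) = Σ_a Σ_{b ≠ a} cos(2k_a) cos(2k_b) / (d(d−1))`.
[cite: FitznerVanDerHofstad2016NoBLE, (3.34) p. 1071] -/
theorem DhatSym_single_two_add_single_two {i j : Fin d} (hij : i ≠ j) (k : Fin d → ℝ) :
    DhatSym d (Pi.single i (2 : ℤ) + Pi.single j 2) k
      = (∑ a, ∑ b ∈ univ.erase a, Real.cos (2 * k a) * Real.cos (2 * k b)) / ((d : ℝ) * (d - 1)) := by
  classical
  rw [DhatSym_eq_sum_permProd]
  simp_rw [permProd_single_add_single hij]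
  have hinv : ∑ ν : Equiv.Perm (Fin d), Real.cos (2 * k (ν.symm i)) * Real.cos (2 * k (ν.symm j))
      = ∑ ν : Equiv.Perm (Fin d), Real.cos (2 * k (ν i)) * Real.cos (2 * k (ν j)) := by
    have h := Equiv.sum_comp (Equiv.inv (Equiv.Perm (Fin d)))
      (fun ν => Real.cos (2 * k (ν i)) * Real.cos (2 * k (ν j)))
    simpa [Equiv.Perm.inv_def] using h
  rw [hinv]
  have h := sum_perm_pair_eq (fun a b => Real.cos (2 * k a) * Real.cos (2 * k b)) hij
  have hd2 : (2 : ℝ) ≤ d := by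
    have : 1 < Fintype.card (Fin d) := Fintype.one_lt_card_iff_nontrivial.mpr ⟨⟨i, j, hij⟩⟩
    rw [Fintype.card_fin] at this
    exact_mod_cast this
  have hne : (d : ℝ) * (d - 1) ≠ 0 := mul_ne_zero (by linarith) (by linarith)
  have hfac : (d.factorial : ℝ) ≠ 0 := by positivity
  rw [div_eq_div_iff hfac hne]
  linear_combination h


/-! ### `(D̂^{sin})²` and `V_{n,a}` through the `I`-table classes `0`, `[2]`, `[4]`, `[2,2]` -/

/-- `4e_i = 2 · (2e_i)` as lattice vectors. [folklore] -/
private theorem single_four_eq (i : Fin d) :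
    (Pi.single i (4 : ℤ) : Fin d → ℤ) = fun j => 2 * (Pi.single i (2 : ℤ) : Fin d → ℤ) j := by
  funext j
  by_cases h : j = i
  · subst h; simp
  · simp [Pi.single_eq_of_ne h]

/-- `D̂^{(4e_i)}(k) = D̂(4k)`. [cite: FitznerVanDerHofstad2016NoBLE, (3.34) p. 1071] -/
theorem DhatSym_single_four (i : Fin d) (k : Fin d → ℝ) :
    DhatSym d (Pi.single i 4) k = Dhat d (fun j => 4 * k j) := by
  rw [single_four_eq i, DhatSym_smul 2 (Pi.single i 2) k, DhatSym_single_two]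
  congr 1
  funext j
  push_cast
  ring

/-- **`(D̂^{sin})²` in the table classes**: for `i ≠ j`,
`D̂^{sin}(k)² = (4d²)⁻¹ [ (1 + 1/(2d)) D̂^{(0)} − 2 D̂^{(2e_i)} + (1/(2d)) D̂^{(4e_i)} + ((d−1)/d) D̂^{(2e_i+2e_j)} ](k)`.
[cite: FitznerVanDerHofstad2016NoBLE, §5.2 p. 1093 ("D̂^{sin}(k)² = (2d)⁻²[1 − D̂(2k)]²")] -/
theorem Dsin_sq_eq_classes {i j : Fin d} (hij : i ≠ j) (k : Fin d → ℝ) :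
    Dsin d k ^ 2 = ((1 + 1 / (2 * d)) * DhatSym d 0 k - 2 * DhatSym d (Pi.single i 2) k
      + (1 / (2 * d)) * DhatSym d (Pi.single i 4) k
      + ((d - 1) / d) * DhatSym d (Pi.single i (2 : ℤ) + Pi.single j 2) k) / (4 * (d : ℝ) ^ 2) := by
  have hd2 : (2 : ℝ) ≤ d := by
    have : 1 < Fintype.card (Fin d) := Fintype.one_lt_card_iff_nontrivial.mpr ⟨⟨i, j, hij⟩⟩
    rw [Fintype.card_fin] at this
    exact_mod_cast this
  have hd1 : 1 ≤ d := by exact_mod_cast (show (1 : ℝ) ≤ d by linarith)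
  have hd0 : (d : ℝ) ≠ 0 := by positivity
  have hdm : (d : ℝ) - 1 ≠ 0 := by linarith
  rw [Dsin_sq_eq hd1 k, DhatSym_zero, DhatSym_single_two, DhatSym_single_four,
    DhatSym_single_two_add_single_two hij]
  field_simp

/-- **`V_{n,a}` from the `I`-tables** (generic range `d ≥ 2n + 1`, `i ≠ j`):
`V_{n,a} = (4d²)⁻¹ [ (1 + 1/(2d)) I_{n,a}(0) − 2 I_{n,a}(2e_i) + (1/(2d)) I_{n,a}(4e_i) + ((d−1)/d) I_{n,a}(2e_i+2e_j) ]`.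
[cite: FitznerVanDerHofstad2016NoBLE, (5.8) p. 1091 and §5.2 p. 1093] -/
theorem srwV_eq_srwI_classes {n : ℕ} (hd : 2 * n + 1 ≤ d) {i j : Fin d} (hij : i ≠ j) (a : ℕ) :
    srwV d n a = ((1 + 1 / (2 * d)) * srwI d n a 0 - 2 * srwI d n a (Pi.single i 2)
      + (1 / (2 * d)) * srwI d n a (Pi.single i 4)
      + ((d - 1) / d) * srwI d n a (Pi.single i (2 : ℤ) + Pi.single j 2)) / (4 * (d : ℝ) ^ 2) := by
  have h0 := integrable_srwI_integrand hd a (0 : Fin d → ℤ)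
  have h2 := integrable_srwI_integrand hd a (Pi.single i (2 : ℤ))
  have h4 := integrable_srwI_integrand hd a (Pi.single i (4 : ℤ))
  have h22 := integrable_srwI_integrand hd a (Pi.single i (2 : ℤ) + Pi.single j 2)
  have hA := h0.const_mul (1 + 1 / (2 * (d : ℝ)))
  have hB := h2.const_mul (2 : ℝ)
  have hC := h4.const_mul (1 / (2 * (d : ℝ)))
  have hD := h22.const_mul (((d : ℝ) - 1) / d)
  have e : ∫ k, (Dhat d k ^ a * Dsin d k ^ 2) * Chat d 1 k ^ n ∂P d
      = ∫ k, ((1 + 1 / (2 * (d : ℝ))) * ((Dhat d k ^ a * DhatSym d 0 k) * Chat d 1 k ^ n)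
          - 2 * ((Dhat d k ^ a * DhatSym d (Pi.single i 2) k) * Chat d 1 k ^ n)
          + 1 / (2 * (d : ℝ)) * ((Dhat d k ^ a * DhatSym d (Pi.single i 4) k) * Chat d 1 k ^ n)
          + ((d : ℝ) - 1) / d * ((Dhat d k ^ a * DhatSym d (Pi.single i (2 : ℤ) + Pi.single j 2) k)
              * Chat d 1 k ^ n)) / (4 * (d : ℝ) ^ 2) ∂P d := by
    refine integral_congr_ae (ae_of_all _ fun k => ?_)
    simp only
    rw [show Dhat d k ^ a * Dsin d k ^ 2 * Chat d 1 k ^ n = Dhat d k ^ a * Chat d 1 k ^ n * Dsin d k ^ 2 by ring,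
      Dsin_sq_eq_classes hij k]
    ring
  unfold srwV srwI
  rw [e, integral_div, integral_add, integral_add, integral_sub, integral_const_mul, integral_const_mul,
    integral_const_mul, integral_const_mul]
  · ring
  all_goals first
    | exact hA | exact hB | exact hC | exact hD | exact hA.sub hB | exact (hA.sub hB).add hC

/-! ## Part II — the square of an axis class (leaf KU-SEP-Q2) -/

section AxisSquare
variable {d : ℕ}

/-- `m e_i = m · (1 e_i)` coordinatewise. [folklore] -/
private theorem single_int_eq_smul (i : Fin d) (m : ℤ) :
    (Pi.single i m : Fin d → ℤ) = fun j => m * (Pi.single i (1 : ℤ) : Fin d → ℤ) j := by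
  funext j
  by_cases h : j = i
  · subst h; simp
  · simp [h]

/-- `m e_i + m e_j = m · (e_i + e_j)` coordinatewise. [folklore] -/
private theorem single_add_single_int_eq_smul (i j : Fin d) (m : ℤ) :
    (Pi.single i m + Pi.single j m : Fin d → ℤ)
      = fun a => m * (Pi.single i (1 : ℤ) + Pi.single j 1 : Fin d → ℤ) a := by
  funext a
  simp only [Pi.add_apply, mul_add]
  congr 1
  · by_cases h : a = i
    · subst h; simp
    · simp [h]
  · by_cases h : a = j
    · subst h; simp
    · simp [h]

/-- **The class `[m,m]`**: for `i ≠ j`, `D̂^{(m e_i + m e_j)}(k) = Σ_a Σ_{b ≠ a} cos(m k_a) cos(m k_b) / (d(d−1))`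
(from the `[2,2]` identity at the rescaled point `(m/2)·k`). [cite: FitznerVanDerHofstad2016NoBLE, (3.34) p. 1071] -/
theorem DhatSym_single_add_single_int {i j : Fin d} (hij : i ≠ j) (m : ℤ) (k : Fin d → ℝ) :
    DhatSym d (Pi.single i m + Pi.single j m) k
      = (∑ a, ∑ b ∈ univ.erase a, Real.cos ((m : ℝ) * k a) * Real.cos ((m : ℝ) * k b)) / ((d : ℝ) * (d - 1)) := by
  have h1 : DhatSym d (Pi.single i m + Pi.single j m) k
      = DhatSym d (Pi.single i (1 : ℤ) + Pi.single j 1) (fun a => (m : ℝ) * k a) := by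
    rw [single_add_single_int_eq_smul, DhatSym_smul]
  have h2 : DhatSym d (Pi.single i (2 : ℤ) + Pi.single j 2) (fun a => ((m : ℝ) / 2) * k a)
      = DhatSym d (Pi.single i (1 : ℤ) + Pi.single j 1) (fun a => (m : ℝ) * k a) := by
    rw [single_add_single_int_eq_smul i j 2, DhatSym_smul]
    congr 1
    funext a
    push_cast
    ring
  rw [h1, ← h2, DhatSym_single_two_add_single_two hij]
  congr 1
  refine Finset.sum_congr rfl fun a _ => Finset.sum_congr rfl fun b _ => ?_
  rw [show (2 : ℝ) * ((m : ℝ) / 2 * k a) = (m : ℝ) * k a by ring,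
    show (2 : ℝ) * ((m : ℝ) / 2 * k b) = (m : ℝ) * k b by ring]

/-- **KU-SEP-Q2, pointwise**: for `i ≠ j` and any `m : ℤ`,
`D̂^{(m e_i)}(k)² = (1 + D̂^{(2m e_i)}(k))/(2d) + ((d−1)/d)·D̂^{(m e_i + m e_j)}(k)`.
[cite: FitznerVanDerHofstad2016NoBLE, (3.34) p. 1071 and §5.2 p. 1093] -/
theorem DhatSym_single_sq_eq_classes {i j : Fin d} (hij : i ≠ j) (m : ℤ) (k : Fin d → ℝ) :
    DhatSym d (Pi.single i m) k ^ 2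
      = (1 + DhatSym d (Pi.single i (2 * m)) k) / (2 * d)
        + ((d : ℝ) - 1) / d * DhatSym d (Pi.single i m + Pi.single j m) k := by
  have hd2 : (2 : ℝ) ≤ d := by
    have : 1 < Fintype.card (Fin d) := Fintype.one_lt_card_iff_nontrivial.mpr ⟨⟨i, j, hij⟩⟩
    rw [Fintype.card_fin] at this
    exact_mod_cast this
  have hd1 : 1 ≤ d := by
    have : (1 : ℝ) ≤ d := by linarith
    exact_mod_cast this
  -- `D̂^{(m e_i)}(k) = D̂(m k)` (public form: `DhatSym_single_intCast` in `SrwChatPowSchwinger.lean`)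
  have h1 : DhatSym d (Pi.single i m) k = Dhat d (fun j => (m : ℝ) * k j) := by
    rw [single_int_eq_smul i m, DhatSym_smul m (Pi.single i 1) k, DhatSym_single]
  have h2 : DhatSym d (Pi.single i (2 * m)) k = Dhat d (fun j => ((2 * m : ℤ) : ℝ) * k j) := by
    rw [single_int_eq_smul i (2 * m), DhatSym_smul (2 * m) (Pi.single i 1) k, DhatSym_single]
  rw [h1, Dhat_sq_eq hd1, h2, DhatSym_single_add_single_int hij]
  have e : (fun j => (2 : ℝ) * ((m : ℝ) * k j)) = fun j => (((2 * m : ℤ) : ℝ)) * k j := by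
    funext j; push_cast; ring
  rw [e]
  have hne : (d : ℝ) - 1 ≠ 0 := by linarith
  have hd0 : (d : ℝ) ≠ 0 := by linarith
  field_simp

/-- **KU-SEP-Q2, integrated against a `K`-weight with even exponent**: for `2n+1 ≤ d`, `i ≠ j`, any `m : ℤ`,
`∫ |D̂|^{2l} (D̂^{(m e_i)})² Ĉⁿ dk/(2π)^d = (I_{n,2l}(0) + I_{n,2l}(2m e_i))/(2d) + ((d−1)/d)·I_{n,2l}(m e_i + m e_j)`.
[cite: FitznerVanDerHofstad2016NoBLE, (5.4) p. 1091 and (3.34) p. 1071] -/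
theorem integral_abs_Dhat_pow_even_mul_DhatSym_single_sq {n : ℕ} (hd : 2 * n + 1 ≤ d) (l : ℕ)
    {i j : Fin d} (hij : i ≠ j) (m : ℤ) :
    (∫ k, (|Dhat d k| ^ (2 * l) * DhatSym d (Pi.single i m) k ^ 2) * Chat d 1 k ^ n ∂P d) / (2 * π) ^ d
      = (srwI d n (2 * l) 0 + srwI d n (2 * l) (Pi.single i (2 * m))) / (2 * d)
        + ((d : ℝ) - 1) / d * srwI d n (2 * l) (Pi.single i m + Pi.single j m) := by
  have hI0 := integrable_srwI_integrand hd (2 * l) (0 : Fin d → ℤ)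
  have hI2 := integrable_srwI_integrand hd (2 * l) (Pi.single i (2 * m))
  have hI11 := integrable_srwI_integrand hd (2 * l) (Pi.single i m + Pi.single j m)
  have hpt : ∀ k, (|Dhat d k| ^ (2 * l) * DhatSym d (Pi.single i m) k ^ 2) * Chat d 1 k ^ n
      = (1 / (2 * d)) * ((Dhat d k ^ (2 * l) * DhatSym d 0 k) * Chat d 1 k ^ n)
        + (1 / (2 * d)) * ((Dhat d k ^ (2 * l) * DhatSym d (Pi.single i (2 * m)) k) * Chat d 1 k ^ n)
        + (((d : ℝ) - 1) / d)
          * ((Dhat d k ^ (2 * l) * DhatSym d (Pi.single i m + Pi.single j m) k) * Chat d 1 k ^ n) := by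
    intro k
    rw [DhatSym_single_sq_eq_classes hij m k, DhatSym_zero, pow_mul, sq_abs, ← pow_mul]
    ring
  simp_rw [hpt]
  have hA : Integrable (fun k => (1 / (2 * d)) * ((Dhat d k ^ (2 * l) * DhatSym d 0 k) * Chat d 1 k ^ n)
        + (1 / (2 * d)) * ((Dhat d k ^ (2 * l) * DhatSym d (Pi.single i (2 * m)) k) * Chat d 1 k ^ n)) (P d) :=
    (hI0.const_mul _).add (hI2.const_mul _)
  rw [integral_add hA (hI11.const_mul _), integral_add (hI0.const_mul _) (hI2.const_mul _),
    integral_const_mul, integral_const_mul, integral_const_mul]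
  simp only [srwI]
  have hπ : (0 : ℝ) < (2 * π) ^ d := by positivity
  have hd0 : (d : ℝ) ≠ 0 := by
    have : 0 < d := Fin.pos i
    positivity
  field_simp

/-- **`L_n` at an axis node** (the `l = 0` case): for `2n+1 ≤ d`, `i ≠ j`, any `m : ℤ`,
`L_n(m e_i) = (I_{n,0}(0) + I_{n,0}(2m e_i))/(2d) + ((d−1)/d)·I_{n,0}(m e_i + m e_j)` — so the Cauchy–Schwarz
bound `K_{n,l}(x) ≤ √(I_{n,2l}(0) L_n(x))` (`srwK_le_sqrt_srwI_mul_srwL`) at axis nodes needs plain seeds only.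
[cite: FitznerVanDerHofstad2016NoBLE, (5.7) and (5.9) p. 1091] -/
theorem srwL_single_eq_classes {n : ℕ} (hd : 2 * n + 1 ≤ d) {i j : Fin d} (hij : i ≠ j) (m : ℤ) :
    srwL d n (Pi.single i m)
      = (srwI d n 0 0 + srwI d n 0 (Pi.single i (2 * m))) / (2 * d)
        + ((d : ℝ) - 1) / d * srwI d n 0 (Pi.single i m + Pi.single j m) := by
  have h := integral_abs_Dhat_pow_even_mul_DhatSym_single_sq hd 0 hij m
  simp only [mul_zero, pow_zero, one_mul] at h
  rw [srwL]
  exact h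

end AxisSquare

end Literature.Probability.FitznerVanDerHofstad2017
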